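import Literature.Analysis.FunctionSpaces.BesselJLargeArgument
import Mathlib.Analysis.SpecialFunctions.Pow.Asymptotics
import HarnessLib

/-!
# Weber–Schafheitlin integrals `∫₀^∞ J_ℓ J_m dx/x` for integer orders (Iwaniec, GSM 53, (B.37)): orthogonality of the `J_ℓ`

Topic `Analysis/FunctionSpaces` (namespace `Literature.Analysis.FunctionSpaces`), continuing `BesselJ.lean`,
`BesselJProofs.lean` (derivative recurrences, decay), `BesselJAnalyticProofs.lean` and `BesselJLargeArgument.lean`
(Hankel's asymptotic formula `abs_besselJ_sub_hankel_le`). Iwaniec [Iwaniec2002, Appendix B.4 (B.37), PDF p. 205]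
records the discontinuous integral `∫₀^∞ J_μ(x)J_ν(x)x⁻¹dx = 2 sin(π(μ−ν)/2)/(π(μ²−ν²))` (`Re(μ+ν) > 0`), whose
integer cases are the orthogonality relations behind the Neumann series `f⁰(x) = Σ_{ℓ odd} 2ℓ N_f(ℓ)J_ℓ(x)`,
`N_f(ℓ) = ∫₀^∞ f(x)J_ℓ(x)dx/x` ((B.44)–(B.46)), i.e. the projection onto the span of the odd-order `J_ℓ` in
`L²(ℝ⁺, x⁻¹dx)` that complements the continuous `J`-Bessel transform in the Sears–Titchmarsh inversion (B.50) used for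
the plus sign of Kuznetsov's formula (Theorems 9.5–9.8). This file PROVES the integer cases:

* `integral_Ioi_besselJ_sq_div` — `∫₀^∞ J_ℓ(x)² dx/x = 1/(2ℓ)` for `ℓ ≥ 1` (§7; elementary: `2ℓJ_ℓ/x = J_{ℓ−1} + J_{ℓ+1}`
  and `∫₀^R J_jJ_{j+1}dx = (1 − J₀(R)²)/2 − Σ_{1≤i≤j}J_i(R)² → 1/2`, `integral_besselJ_mul_besselJ_succ`);
* `integral_Ioi_besselJ_mul_besselJ_div` — `∫₀^∞ J_ℓJ_m dx/x = 2 sin((ℓ−m)π/2)/(π(ℓ²−m²))` for `ℓ ≠ m`, `ℓ + m ≥ 1` (§8: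
  the Wronskian `W_{ℓm} = (ℓ−m)J_ℓJ_m + x(J_ℓJ_{m+1} − J_{ℓ+1}J_m) = x(J_ℓ'J_m − J_ℓJ_m')` has
  `W' = (ℓ²−m²)J_ℓJ_m/x` (`hasDerivAt_besselW`), `W(0) = 0`, and `W(R) → (2/π)sin((ℓ−m)π/2)` by Hankel's asymptotics,
  `tendsto_besselW`; the tree's `integral_Ioi_besselJ_zero_mul_besselJ_one_div = 2/π` is the case `(ℓ, m) = (0, 1)`);
* `integral_Ioi_besselJ_mul_besselJ_div_eq_zero` — orthogonality for `ℓ ≡ m (mod 2)`, `ℓ ≠ m`.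

## References
* [Iwaniec2002] H. Iwaniec, *Spectral Methods of Automorphic Forms*, 2nd ed., GSM 53, AMS 2002, Appendix B.4 (B.37),
  B.5 (B.44)–(B.46), (B.50), PDF pp. 205–206 (held copy `book:iwaniec2002-spectral-methods-automorphic-forms`).
* G. N. Watson, *A Treatise on the Theory of Bessel Functions*, 2nd ed. (1944), §5.11 (Lommel's integrals),
  §13.42 (the Weber–Schafheitlin integral, critical cases).

Literature: `besselJ`, `besselJ_zero_zero`, `besselJ_succ_apply_zero`, `besselJ_recurrence_holds`,
`hasDerivAt_besselJ_zero_holds`, `hasDerivAt_besselJ_succ_everywhere`, `hasDerivAt_besselJ_of_ne_zero`,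
`hasDerivAt_besselJ_succ_of_ne_zero`, `continuous_besselJ_holds`, `abs_besselJ_le_one_holds`,
`abs_besselJ_le_pow_div_factorial`, `abs_besselJ_le_mul_rpow_neg_half` (`BesselJ*.lean`); `abs_besselJ_sub_hankel_le`
(`BesselJLargeArgument.lean`). Mathlib: `intervalIntegral.integral_eq_sub_of_hasDerivAt(_of_le)`,
`intervalIntegral_tendsto_integral_Ioi`, `integrableOn_Ioi_rpow_of_lt`, `tendsto_rpow_neg_atTop`, `Real.sin_int_mul_pi`.
-/

noncomputable section

open MeasureTheory Set Filter Real intervalIntegral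
open scoped Topology

namespace Literature.Analysis.FunctionSpaces

/-! ### §7. The diagonal case `∫₀^∞ J_ℓ(x)² dx/x = 1/(2ℓ)` -/

/-- `F_j(R) = ∫₀^R J_j J_{j+1} dx = (1 − J₀(R)²)/2 − Σ_{1 ≤ i ≤ j} J_i(R)²`. [folklore] -/
theorem integral_besselJ_mul_besselJ_succ (j : ℕ) (R : ℝ) :
    ∫ x in (0 : ℝ)..R, besselJ j x * besselJ (j + 1) x =
      (1 - besselJ 0 R ^ 2) / 2 - ∑ i ∈ Finset.range j, besselJ (i + 1) R ^ 2 := by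
  induction j with
  | zero =>
    -- `(J₀²)' = -2 J₀ J₁`
    have hd : ∀ x ∈ Set.uIcc 0 R, HasDerivAt (fun x => besselJ 0 x ^ 2) (2 * besselJ 0 x * (-besselJ 1 x)) x :=
      fun x _ => by simpa using (hasDerivAt_besselJ_zero_holds x).fun_pow 2
    have hint : IntervalIntegrable (fun x => 2 * besselJ 0 x * (-besselJ 1 x)) volume 0 R :=
      ((continuous_const.mul (continuous_besselJ_holds 0)).mul (continuous_besselJ_holds 1).neg).intervalIntegrable _ _
    have h := intervalIntegral.integral_eq_sub_of_hasDerivAt hd hint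
    simp only [besselJ_zero_zero, Finset.range_zero, Finset.sum_empty, sub_zero, Nat.zero_add] at h ⊢
    have : ∫ x in (0 : ℝ)..R, besselJ 0 x * besselJ 1 x = -(1 / 2) * ∫ x in (0 : ℝ)..R, 2 * besselJ 0 x * -besselJ 1 x := by
      rw [← intervalIntegral.integral_const_mul]
      refine intervalIntegral.integral_congr fun x _ => ?_; ring
    rw [this, h]; ring
  | succ j ih =>
    -- `(J_{j+1}²)' = J_{j+1}(J_j − J_{j+2})`
    have hd : ∀ x ∈ Set.uIcc 0 R, HasDerivAt (fun x => besselJ (j + 1) x ^ 2)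
        (2 * besselJ (j + 1) x * ((besselJ j x - besselJ (j + 2) x) / 2)) x :=
      fun x _ => by simpa using (hasDerivAt_besselJ_succ_everywhere j x).fun_pow 2
    have hint : IntervalIntegrable (fun x => 2 * besselJ (j + 1) x * ((besselJ j x - besselJ (j + 2) x) / 2)) volume 0 R :=
      ((continuous_const.mul (continuous_besselJ_holds _)).mul
        (((continuous_besselJ_holds _).sub (continuous_besselJ_holds _)).div_const _)).intervalIntegrable _ _
    have h := intervalIntegral.integral_eq_sub_of_hasDerivAt hd hint
    simp only [besselJ_succ_apply_zero] at h
    have i1 : IntervalIntegrable (fun x => besselJ j x * besselJ (j + 1) x) volume 0 R :=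
      ((continuous_besselJ_holds _).mul (continuous_besselJ_holds _)).intervalIntegrable _ _
    have i2 : IntervalIntegrable (fun x => besselJ (j + 1) x * besselJ (j + 1 + 1) x) volume 0 R :=
      ((continuous_besselJ_holds _).mul (continuous_besselJ_holds _)).intervalIntegrable _ _
    have hsplit : (∫ x in (0 : ℝ)..R, 2 * besselJ (j + 1) x * ((besselJ j x - besselJ (j + 2) x) / 2)) =
        (∫ x in (0 : ℝ)..R, besselJ j x * besselJ (j + 1) x) - ∫ x in (0 : ℝ)..R, besselJ (j + 1) x * besselJ (j + 1 + 1) x := by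
      rw [← intervalIntegral.integral_sub i1 i2]
      refine intervalIntegral.integral_congr fun x _ => ?_
      simp only [show j + 1 + 1 = j + 2 by ring]; ring
    rw [hsplit, ih] at h
    rw [Finset.sum_range_succ]
    have : (0 : ℝ) ^ 2 = 0 := by norm_num
    rw [this] at h
    linarith

/-- The pointwise identity `J_{k+1}²/x = J_{k+1}(J_k + J_{k+2})/(2(k+1))` (the recurrence; at `x = 0` both sides
vanish). [folklore] -/
theorem besselJ_succ_sq_div_eq (k : ℕ) (x : ℝ) :
    besselJ (k + 1) x ^ 2 / x = besselJ (k + 1) x * (besselJ k x + besselJ (k + 2) x) / (2 * (k + 1)) := by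
  by_cases hx : x = 0
  · subst hx; simp [besselJ_succ_apply_zero]
  · rw [besselJ_recurrence_holds k hx]
    field_simp

/-- `∫₀^R J_{k+1}(x)²/x dx = (F_k(R) + F_{k+1}(R))/(2(k+1))`. [folklore] -/
theorem integral_besselJ_succ_sq_div (k : ℕ) (R : ℝ) :
    ∫ x in (0 : ℝ)..R, besselJ (k + 1) x ^ 2 / x =
      ((∫ x in (0 : ℝ)..R, besselJ k x * besselJ (k + 1) x) + ∫ x in (0 : ℝ)..R, besselJ (k + 1) x * besselJ (k + 1 + 1) x) /
        (2 * (k + 1)) := by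
  have i1 : IntervalIntegrable (fun x => besselJ k x * besselJ (k + 1) x) volume 0 R :=
    ((continuous_besselJ_holds _).mul (continuous_besselJ_holds _)).intervalIntegrable _ _
  have i2 : IntervalIntegrable (fun x => besselJ (k + 1) x * besselJ (k + 1 + 1) x) volume 0 R :=
    ((continuous_besselJ_holds _).mul (continuous_besselJ_holds _)).intervalIntegrable _ _
  rw [← intervalIntegral.integral_add i1 i2, ← intervalIntegral.integral_div]
  refine intervalIntegral.integral_congr fun x _ => ?_
  rw [besselJ_succ_sq_div_eq, show k + 1 + 1 = k + 2 by ring]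
  ring

/-- `J_n(R) → 0` as `R → ∞`. [folklore] -/
theorem tendsto_besselJ_atTop (n : ℕ) : Tendsto (besselJ n) atTop (𝓝 0) := by
  obtain ⟨C, hC⟩ := abs_besselJ_le_mul_rpow_neg_half n
  have hlim : Tendsto (fun x : ℝ => C * x ^ (-(1 / 2 : ℝ))) atTop (𝓝 0) := by
    have := (tendsto_rpow_neg_atTop (by norm_num : (0 : ℝ) < 1 / 2)).const_mul C
    simpa using this
  refine squeeze_zero_norm' ?_ hlim
  filter_upwards [Filter.eventually_ge_atTop ((n : ℝ) + 1)] with x hx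
  rw [Real.norm_eq_abs]; exact hC x hx

/-- `F_j(R) → 1/2` as `R → ∞`. [folklore] -/
theorem tendsto_integral_besselJ_mul_besselJ_succ (j : ℕ) :
    Tendsto (fun R => ∫ x in (0 : ℝ)..R, besselJ j x * besselJ (j + 1) x) atTop (𝓝 (1 / 2)) := by
  have e : (fun R => ∫ x in (0 : ℝ)..R, besselJ j x * besselJ (j + 1) x) =
      fun R => (1 - besselJ 0 R ^ 2) / 2 - ∑ i ∈ Finset.range j, besselJ (i + 1) R ^ 2 := by
    funext R; exact integral_besselJ_mul_besselJ_succ j R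
  rw [e]
  have h0 := tendsto_besselJ_atTop 0
  have h1 : Tendsto (fun R => (1 - besselJ 0 R ^ 2) / 2) atTop (𝓝 ((1 - 0 ^ 2) / 2)) :=
    ((tendsto_const_nhds.sub (h0.pow 2)).div_const 2)
  have h2 : Tendsto (fun R => ∑ i ∈ Finset.range j, besselJ (i + 1) R ^ 2) atTop (𝓝 (∑ i ∈ Finset.range j, (0 : ℝ) ^ 2)) :=
    tendsto_finsetSum _ fun i _ => (tendsto_besselJ_atTop (i + 1)).pow 2
  have := h1.sub h2
  simpa using this

/-- `∫₀^R J_ℓ²/x dx → 1/(2ℓ)` (`ℓ ≥ 1`). [folklore] -/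
theorem tendsto_integral_besselJ_succ_sq_div (k : ℕ) :
    Tendsto (fun R => ∫ x in (0 : ℝ)..R, besselJ (k + 1) x ^ 2 / x) atTop (𝓝 (1 / (2 * (k + 1)))) := by
  have e : (fun R => ∫ x in (0 : ℝ)..R, besselJ (k + 1) x ^ 2 / x) = fun R =>
      ((∫ x in (0 : ℝ)..R, besselJ k x * besselJ (k + 1) x) + ∫ x in (0 : ℝ)..R, besselJ (k + 1) x * besselJ (k + 1 + 1) x) /
        (2 * (k + 1)) := by
    funext R; exact integral_besselJ_succ_sq_div k R
  rw [e]
  have := ((tendsto_integral_besselJ_mul_besselJ_succ k).add (tendsto_integral_besselJ_mul_besselJ_succ (k + 1))).div_const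
    (2 * ((k : ℝ) + 1))
  convert this using 2
  ring

/-- Integrability of `J_ℓ²/x` on `(0, ∞)` (`ℓ ≥ 1`): bounded by `1` near `0`... precisely `J_{k+1}(x)²/x ≤ |J_{k+1}(x)|·(1/√2)/x`;
we use `|J_{k+1}(x)| ≤ |x|/2 · e^{x²/4}`-type bounds near `0` and `C² x^{-2}` at infinity. [folklore] -/
theorem integrableOn_besselJ_succ_sq_div (k : ℕ) : IntegrableOn (fun x => besselJ (k + 1) x ^ 2 / x) (Set.Ioi 0) := by
  obtain ⟨C, hC⟩ := abs_besselJ_le_mul_rpow_neg_half (k + 1)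
  have hcont : ContinuousOn (fun x => besselJ (k + 1) x ^ 2 / x) (Set.Ioi 0) :=
    ((continuous_besselJ_holds _).pow 2).continuousOn.div continuousOn_id fun x hx => ne_of_gt hx
  -- split at `b = k + 2`
  set b : ℝ := (k : ℝ) + 2 with hb
  have hb1 : (k + 1 : ℝ) + 1 ≤ b := by rw [hb]; linarith
  have hb0 : 0 < b := by rw [hb]; positivity
  have h1 : IntegrableOn (fun x => besselJ (k + 1) x ^ 2 / x) (Set.Ioc 0 b) := by
    -- bounded by `x/4 · e^{b²/2}`-free crude bound: `J²/x ≤ |J| · |J|/x ≤ 1 · (|x|/2 e^{x²/4}) ^2 / x`; simpler: `|J_{k+1}(x)| ≤ |x/2|^{k+1}/(k+1)! e^{|x/2|²} ≤ (b/2)^{k} |x|/2 … `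
    -- we use: `J_{k+1}(x)^2 / x ≤ |J_{k+1} x| * (|x/2|^{k+1}/(k+1)! * exp(|x/2|^2)) / x ≤ 1 * |x|/2 * (b/2)^k/(k+1)! e^{b²/4} / x`
    refine (integrableOn_const (C := (b / 2) ^ k * Real.exp ((b / 2) ^ 2)) (by simp)).mono' ?_ ?_
    · exact (hcont.mono Set.Ioc_subset_Ioi_self).aestronglyMeasurable measurableSet_Ioc
    · refine (ae_restrict_mem measurableSet_Ioc).mono fun x hx => ?_
      have hx0 : 0 < x := hx.1
      rw [Real.norm_eq_abs, abs_div, abs_of_pos hx0, abs_pow, div_le_iff₀ hx0]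
      have hJ1 : |besselJ (k + 1) x| ≤ 1 := abs_besselJ_le_one_holds _ _
      have hJ2 := abs_besselJ_le_pow_div_factorial (k + 1) x
      have hx2 : |x / 2| = x / 2 := abs_of_pos (by positivity)
      rw [hx2] at hJ2
      have hfac : (1 : ℝ) ≤ ((Nat.factorial (k + 1) : ℕ) : ℝ) := by
        exact_mod_cast Nat.one_le_iff_ne_zero.mpr (Nat.factorial_ne_zero _)
      have hxb : x / 2 ≤ b / 2 := by linarith [hx.2]
      have hpow : (x / 2) ^ (k + 1) / ((Nat.factorial (k + 1) : ℕ) : ℝ) ≤ (x / 2) * (b / 2) ^ k := by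
        rw [div_le_iff₀ (by positivity), pow_succ]
        calc (x / 2) ^ k * (x / 2) ≤ (b / 2) ^ k * (x / 2) := by gcongr
          _ = x / 2 * (b / 2) ^ k * 1 := by ring
          _ ≤ x / 2 * (b / 2) ^ k * ((Nat.factorial (k + 1) : ℕ) : ℝ) := by gcongr
      have hexp : Real.exp ((x / 2) ^ 2) ≤ Real.exp ((b / 2) ^ 2) := by
        rw [Real.exp_le_exp]; gcongr
      have hbk : 0 ≤ (b / 2) ^ k := pow_nonneg (by positivity) k
      have hE : 0 < Real.exp ((b / 2) ^ 2) := Real.exp_pos _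
      calc |besselJ (k + 1) x| ^ 2 = |besselJ (k + 1) x| * |besselJ (k + 1) x| := sq _
        _ ≤ 1 * ((x / 2) ^ (k + 1) / ((Nat.factorial (k + 1) : ℕ) : ℝ) * Real.exp ((x / 2) ^ 2)) :=
            mul_le_mul hJ1 hJ2 (abs_nonneg _) (by norm_num)
        _ ≤ 1 * ((x / 2) * (b / 2) ^ k * Real.exp ((b / 2) ^ 2)) := by gcongr
        _ = (b / 2) ^ k * Real.exp ((b / 2) ^ 2) * x / 2 := by ring
        _ ≤ (b / 2) ^ k * Real.exp ((b / 2) ^ 2) * x := by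
            have : 0 ≤ (b / 2) ^ k * Real.exp ((b / 2) ^ 2) * x := by positivity
            linarith
  have h2 : IntegrableOn (fun x => besselJ (k + 1) x ^ 2 / x) (Set.Ioi b) := by
    have hib : IntegrableOn (fun x : ℝ => C ^ 2 * x ^ (-2 : ℝ)) (Set.Ioi b) :=
      ((integrableOn_Ioi_rpow_of_lt (by norm_num) hb0).const_mul _)
    refine hib.mono' ((hcont.mono (Set.Ioi_subset_Ioi hb0.le)).aestronglyMeasurable measurableSet_Ioi) ?_
    refine (ae_restrict_mem measurableSet_Ioi).mono fun x hx => ?_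
    have hx0 : 0 < x := hb0.trans hx
    have hxb : b < x := hx
    have hJ := hC x (by push_cast; linarith [hb1])
    rw [Real.norm_eq_abs, abs_div, abs_of_pos hx0, abs_pow]
    have hC0 : 0 ≤ C := by
      have := (abs_nonneg _).trans hJ
      have hr : 0 < x ^ (-(1 / 2 : ℝ)) := Real.rpow_pos_of_pos hx0 _
      nlinarith
    calc |besselJ (k + 1) x| ^ 2 / x ≤ (C * x ^ (-(1 / 2 : ℝ))) ^ 2 / x := by gcongr
      _ = C ^ 2 * x ^ (-2 : ℝ) := by
          have e1 : (x ^ (-(1 / 2 : ℝ))) ^ 2 = x ^ (-1 : ℝ) := by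
            rw [← Real.rpow_natCast, ← Real.rpow_mul hx0.le]; norm_num
          have e2 : x ^ (-1 : ℝ) / x = x ^ (-2 : ℝ) := by
            rw [Real.rpow_neg_one, show (-2 : ℝ) = -1 + -1 by norm_num, Real.rpow_add hx0, Real.rpow_neg_one]
            field_simp
          rw [mul_pow, e1, mul_div_assoc, e2]
  have := h1.union h2
  rwa [Set.Ioc_union_Ioi_eq_Ioi hb0.le] at this

/-- **`∫₀^∞ J_ℓ(x)² dx/x = 1/(2ℓ)`** for `ℓ ≥ 1` [Iwaniec2002, (B.37) with `μ = ν = ℓ`; Watson §13.42]: the normalisation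
of the Neumann series `f⁰ = Σ_{ℓ odd} 2ℓ N_f(ℓ) J_ℓ` ((B.44)–(B.46)). Proof: `2ℓJ_ℓ/x = J_{ℓ−1} + J_{ℓ+1}`,
`∫₀^R J_jJ_{j+1} = (1 − J₀(R)²)/2 − Σ_{i≤j}J_i(R)²` (from `(J_i²)' = J_i(J_{i−1} − J_{i+1})`, `(J₀²)' = −2J₀J₁`) `→ 1/2`.
[cite: Iwaniec2002, Appendix B.4 (B.37), B.5 (B.44)–(B.46), PDF pp. 205–206] -/
theorem integral_Ioi_besselJ_sq_div (k : ℕ) :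
    ∫ x in Set.Ioi (0 : ℝ), besselJ (k + 1) x ^ 2 / x = 1 / (2 * (k + 1)) := by
  have hint := integrableOn_besselJ_succ_sq_div k
  have hlim := intervalIntegral_tendsto_integral_Ioi 0 hint tendsto_id
  exact tendsto_nhds_unique hlim (tendsto_integral_besselJ_succ_sq_div k)

/-! ### §8. The off-diagonal case `∫₀^∞ J_ℓ J_m dx/x = 2 sin((ℓ−m)π/2)/(π(ℓ²−m²))` -/

/-- The Wronskian-type combination `W_{ℓm}(x) = (ℓ−m)J_ℓJ_m + x(J_ℓJ_{m+1} − J_{ℓ+1}J_m)` (`= x(J_ℓ'J_m − J_ℓJ_m')`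
by the derivative recurrences). [folklore] -/
def besselW (l m : ℕ) (x : ℝ) : ℝ :=
  ((l : ℝ) - m) * besselJ l x * besselJ m x + x * (besselJ l x * besselJ (m + 1) x - besselJ (l + 1) x * besselJ m x)

/-- `W_{ℓm}' = (ℓ² − m²) J_ℓ J_m / x` (`x ≠ 0`), from `J_n' = (nJ_n − xJ_{n+1})/x`, `J_{n+1}' = (xJ_n − (n+1)J_{n+1})/x`.
[cite: Iwaniec2002, Appendix B.4 (B.37); Watson §5.11 (8)] -/
theorem hasDerivAt_besselW (l m : ℕ) {x : ℝ} (hx : x ≠ 0) :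
    HasDerivAt (besselW l m) ((((l : ℝ)) ^ 2 - (m : ℝ) ^ 2) * besselJ l x * besselJ m x / x) x := by
  have ha := hasDerivAt_besselJ_of_ne_zero l hx
  have hb := hasDerivAt_besselJ_of_ne_zero m hx
  have ha1 := hasDerivAt_besselJ_succ_of_ne_zero l hx
  have hb1 := hasDerivAt_besselJ_succ_of_ne_zero m hx
  have h := (((ha.fun_mul hb).const_mul (((l : ℝ)) - m)).fun_add
    ((hasDerivAt_id x).fun_mul ((ha.fun_mul hb1).fun_sub (ha1.fun_mul hb))))
  unfold besselW
  refine (h.congr_deriv ?_).congr_of_eventuallyEq (Filter.Eventually.of_forall fun y => by simp only [id]; ring)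
  simp only [id]
  field_simp
  ring

/-- `W_{ℓm}` is continuous. [folklore] -/
theorem continuous_besselW (l m : ℕ) : Continuous (besselW l m) := by
  unfold besselW
  have hJ := continuous_besselJ_holds
  exact ((continuous_const.mul (hJ l)).mul (hJ m)).add
    (continuous_id.mul (((hJ l).mul (hJ (m + 1))).sub ((hJ (l + 1)).mul (hJ m))))

/-- `W_{ℓm}(0) = 0` for `ℓ ≠ m`. [folklore] -/
theorem besselW_zero {l m : ℕ} (hlm : l ≠ m) : besselW l m 0 = 0 := by
  unfold besselW
  rcases Nat.eq_zero_or_pos l with hl | hl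
  · subst hl
    obtain ⟨m', rfl⟩ := Nat.exists_eq_succ_of_ne_zero (Ne.symm hlm)
    simp [besselJ_succ_apply_zero]
  · obtain ⟨l', rfl⟩ := Nat.exists_eq_succ_of_ne_zero (Nat.pos_iff_ne_zero.mp hl)
    simp [besselJ_succ_apply_zero]

/-- Integrability of `J_ℓJ_m/x` on `(0, ∞)` for `ℓ + m ≥ 1`. [folklore] -/
theorem integrableOn_besselJ_mul_besselJ_div {l m : ℕ} (hlm : 1 ≤ l + m) :
    IntegrableOn (fun x => besselJ l x * besselJ m x / x) (Set.Ioi 0) := by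
  obtain ⟨Cl, hCl⟩ := abs_besselJ_le_mul_rpow_neg_half l
  obtain ⟨Cm, hCm⟩ := abs_besselJ_le_mul_rpow_neg_half m
  have hcont : ContinuousOn (fun x => besselJ l x * besselJ m x / x) (Set.Ioi 0) :=
    (((continuous_besselJ_holds _).mul (continuous_besselJ_holds _)).continuousOn).div continuousOn_id
      fun x hx => ne_of_gt hx
  set b : ℝ := (l : ℝ) + m + 1 with hb
  have hb0 : 0 < b := by rw [hb]; positivity
  -- near zero: `|J_l J_m| ≤ (x/2)^{l+m} e^{x²/2} ≤ x · (b/2)^{l+m-1}/2 · e^{b²/2}`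
  have h1 : IntegrableOn (fun x => besselJ l x * besselJ m x / x) (Set.Ioc 0 b) := by
    refine (integrableOn_const (C := (b / 2) ^ (l + m - 1) * Real.exp ((b / 2) ^ 2) ^ 2) (by simp)).mono' ?_ ?_
    · exact (hcont.mono Set.Ioc_subset_Ioi_self).aestronglyMeasurable measurableSet_Ioc
    · refine (ae_restrict_mem measurableSet_Ioc).mono fun x hx => ?_
      have hx0 : 0 < x := hx.1
      rw [Real.norm_eq_abs, abs_div, abs_of_pos hx0, abs_mul, div_le_iff₀ hx0]
      have hJl := abs_besselJ_le_pow_div_factorial l x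
      have hJm := abs_besselJ_le_pow_div_factorial m x
      have hx2 : |x / 2| = x / 2 := abs_of_pos (by positivity)
      rw [hx2] at hJl hJm
      have hfl : (1 : ℝ) ≤ ((Nat.factorial l : ℕ) : ℝ) := by exact_mod_cast Nat.one_le_iff_ne_zero.mpr (Nat.factorial_ne_zero _)
      have hfm : (1 : ℝ) ≤ ((Nat.factorial m : ℕ) : ℝ) := by exact_mod_cast Nat.one_le_iff_ne_zero.mpr (Nat.factorial_ne_zero _)
      have hJl' : |besselJ l x| ≤ (x / 2) ^ l * Real.exp ((x / 2) ^ 2) := by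
        refine hJl.trans ?_
        gcongr
        exact div_le_self (by positivity) hfl
      have hJm' : |besselJ m x| ≤ (x / 2) ^ m * Real.exp ((x / 2) ^ 2) := by
        refine hJm.trans ?_
        gcongr
        exact div_le_self (by positivity) hfm
      have hxb : x / 2 ≤ b / 2 := by linarith [hx.2]
      have hE : Real.exp ((x / 2) ^ 2) ≤ Real.exp ((b / 2) ^ 2) := by rw [Real.exp_le_exp]; gcongr
      obtain ⟨s, hs⟩ : ∃ s : ℕ, l + m = s + 1 := ⟨l + m - 1, by omega⟩
      have hpow : (x / 2) ^ l * (x / 2) ^ m ≤ (b / 2) ^ (l + m - 1) * x := by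
        rw [← pow_add, hs, pow_succ, show s + 1 - 1 = s by omega]
        calc (x / 2) ^ s * (x / 2) ≤ (b / 2) ^ s * (x / 2) := by gcongr
          _ ≤ (b / 2) ^ s * x := by
              have : 0 ≤ (b / 2) ^ s := pow_nonneg (by positivity) s
              nlinarith
      calc |besselJ l x| * |besselJ m x| ≤ ((x / 2) ^ l * Real.exp ((x / 2) ^ 2)) * ((x / 2) ^ m * Real.exp ((x / 2) ^ 2)) :=
            mul_le_mul hJl' hJm' (abs_nonneg _) (by positivity)
        _ = ((x / 2) ^ l * (x / 2) ^ m) * Real.exp ((x / 2) ^ 2) ^ 2 := by ring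
        _ ≤ ((b / 2) ^ (l + m - 1) * x) * Real.exp ((b / 2) ^ 2) ^ 2 := by gcongr
        _ = (b / 2) ^ (l + m - 1) * Real.exp ((b / 2) ^ 2) ^ 2 * x := by ring
  -- at infinity: `≤ Cl Cm x^{-2}`
  have h2 : IntegrableOn (fun x => besselJ l x * besselJ m x / x) (Set.Ioi b) := by
    have hib : IntegrableOn (fun x : ℝ => |Cl| * |Cm| * x ^ (-2 : ℝ)) (Set.Ioi b) :=
      ((integrableOn_Ioi_rpow_of_lt (by norm_num) hb0).const_mul _)
    refine hib.mono' ((hcont.mono (Set.Ioi_subset_Ioi hb0.le)).aestronglyMeasurable measurableSet_Ioi) ?_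
    refine (ae_restrict_mem measurableSet_Ioi).mono fun x hx => ?_
    have hxb : b < x := hx
    have hx0 : 0 < x := hb0.trans hxb
    have hJl := hCl x (by rw [hb] at hxb; linarith)
    have hJm := hCm x (by rw [hb] at hxb; linarith)
    have hr : 0 < x ^ (-(1 / 2 : ℝ)) := Real.rpow_pos_of_pos hx0 _
    rw [Real.norm_eq_abs, abs_div, abs_of_pos hx0, abs_mul]
    calc |besselJ l x| * |besselJ m x| / x ≤ (|Cl| * x ^ (-(1 / 2 : ℝ))) * (|Cm| * x ^ (-(1 / 2 : ℝ))) / x := by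
          gcongr
          · exact hJl.trans (by gcongr; exact le_abs_self _)
          · exact hJm.trans (by gcongr; exact le_abs_self _)
      _ = |Cl| * |Cm| * x ^ (-2 : ℝ) := by
          have e1 : x ^ (-(1 / 2 : ℝ)) * x ^ (-(1 / 2 : ℝ)) = x ^ (-1 : ℝ) := by
            rw [← Real.rpow_add hx0]; norm_num
          have e2 : x ^ (-1 : ℝ) / x = x ^ (-2 : ℝ) := by
            rw [Real.rpow_neg_one, show (-2 : ℝ) = -1 + -1 by norm_num, Real.rpow_add hx0, Real.rpow_neg_one]
            field_simp
          calc _ = |Cl| * |Cm| * ((x ^ (-(1 / 2 : ℝ)) * x ^ (-(1 / 2 : ℝ))) / x) := by ring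
            _ = _ := by rw [e1, e2]
  have := h1.union h2
  rwa [Set.Ioc_union_Ioi_eq_Ioi hb0.le] at this

/-- `∫₀^R J_ℓJ_m dx/x = W_{ℓm}(R)/(ℓ² − m²)` for `ℓ ≠ m`. [folklore] -/
theorem integral_besselJ_mul_besselJ_div_eq {l m : ℕ} (hlm : l ≠ m) {R : ℝ} (hR : 0 ≤ R) :
    ∫ x in (0 : ℝ)..R, besselJ l x * besselJ m x / x = besselW l m R / (((l : ℝ)) ^ 2 - (m : ℝ) ^ 2) := by
  have hne : ((l : ℝ)) ^ 2 - (m : ℝ) ^ 2 ≠ 0 := by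
    intro h
    have : ((l : ℝ)) ^ 2 = (m : ℝ) ^ 2 := by linarith
    have := (sq_eq_sq₀ (Nat.cast_nonneg l) (Nat.cast_nonneg m)).mp this
    exact hlm (by exact_mod_cast this)
  have hlm1 : 1 ≤ l + m := by omega
  have hint : IntervalIntegrable (fun x => (((l : ℝ)) ^ 2 - (m : ℝ) ^ 2) * besselJ l x * besselJ m x / x) volume 0 R := by
    have := ((integrableOn_besselJ_mul_besselJ_div hlm1).mono_set (Set.Ioc_subset_Ioi_self : Set.Ioc (0 : ℝ) R ⊆ Set.Ioi 0)).const_mul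
      (((l : ℝ)) ^ 2 - (m : ℝ) ^ 2)
    rw [intervalIntegrable_iff_integrableOn_Ioc_of_le hR]
    exact IntegrableOn.congr_fun this (fun x _ => by ring) measurableSet_Ioc
  have hFTC := intervalIntegral.integral_eq_sub_of_hasDerivAt_of_le hR (continuous_besselW l m).continuousOn
    (fun x hx => hasDerivAt_besselW l m (ne_of_gt hx.1)) hint
  rw [besselW_zero hlm, sub_zero] at hFTC
  rw [eq_div_iff hne, mul_comm, ← hFTC, ← intervalIntegral.integral_const_mul]
  refine intervalIntegral.integral_congr fun x _ => ?_
  ring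

/-- The main-term identity: with `M_n(R) = √(2/(πR)) cos(R − nπ/2 − π/4)`,
`R(M_ℓ M_{m+1} − M_{ℓ+1} M_m) = (2/π) sin((ℓ−m)π/2)` for `R > 0`. [folklore] -/
theorem hankelMain_wronskian (l m : ℕ) {R : ℝ} (hR : 0 < R) :
    R * (Real.sqrt (2 / (π * R)) * Real.cos (R - l * π / 2 - π / 4) * (Real.sqrt (2 / (π * R)) * Real.cos (R - (m + 1 : ℕ) * π / 2 - π / 4)) -
      Real.sqrt (2 / (π * R)) * Real.cos (R - (l + 1 : ℕ) * π / 2 - π / 4) * (Real.sqrt (2 / (π * R)) * Real.cos (R - m * π / 2 - π / 4))) =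
      2 / π * Real.sin (((l : ℝ) - m) * π / 2) := by
  have hπ := Real.pi_pos
  have hsq : Real.sqrt (2 / (π * R)) * Real.sqrt (2 / (π * R)) = 2 / (π * R) := Real.mul_self_sqrt (by positivity)
  set α : ℝ := R - l * π / 2 - π / 4 with hα
  set β : ℝ := R - m * π / 2 - π / 4 with hβ
  have e1 : Real.cos (R - (m + 1 : ℕ) * π / 2 - π / 4) = Real.sin β := by
    rw [show (R - (m + 1 : ℕ) * π / 2 - π / 4 : ℝ) = β - π / 2 by rw [hβ]; push_cast; ring, Real.cos_sub_pi_div_two]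
  have e2 : Real.cos (R - (l + 1 : ℕ) * π / 2 - π / 4) = Real.sin α := by
    rw [show (R - (l + 1 : ℕ) * π / 2 - π / 4 : ℝ) = α - π / 2 by rw [hα]; push_cast; ring, Real.cos_sub_pi_div_two]
  rw [e1, e2]
  have e3 : Real.sin (((l : ℝ) - m) * π / 2) = Real.sin (β - α) := by
    congr 1; rw [hα, hβ]; ring
  rw [e3, Real.sin_sub β α]
  calc _ = R * (Real.sqrt (2 / (π * R)) * Real.sqrt (2 / (π * R))) * (Real.cos α * Real.sin β - Real.sin α * Real.cos β) := by ring
    _ = _ := by rw [hsq]; field_simp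

/-- `W_{ℓm}(R) → (2/π) sin((ℓ−m)π/2)` as `R → ∞` (Hankel's asymptotics `abs_besselJ_sub_hankel_le`). [folklore] -/
theorem tendsto_besselW (l m : ℕ) :
    Tendsto (besselW l m) atTop (𝓝 (2 / π * Real.sin (((l : ℝ) - m) * π / 2))) := by
  have hπ := Real.pi_pos
  -- notation
  set M : ℕ → ℝ → ℝ := fun n R => Real.sqrt (2 / (π * R)) * Real.cos (R - n * π / 2 - π / 4) with hM
  set κ : ℕ → ℝ := fun n => 17 * (1 + (n : ℝ) ^ 2) with hκ
  have hκ0 : ∀ n, 0 ≤ κ n := fun n => by simp only [hκ]; positivity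
  have hE : ∀ n R, 0 < R → |besselJ n R - M n R| ≤ κ n / R := fun n R hR => abs_besselJ_sub_hankel_le n hR
  have hMb : ∀ n R, 1 ≤ R → |M n R| ≤ R ^ (-(1 / 2 : ℝ)) := by
    intro n R hR
    have hR0 : 0 < R := by linarith
    simp only [hM]
    rw [abs_mul]
    have hc : |Real.cos (R - n * π / 2 - π / 4)| ≤ 1 := Real.abs_cos_le_one _
    have hs : |Real.sqrt (2 / (π * R))| ≤ R ^ (-(1 / 2 : ℝ)) := by
      rw [abs_of_nonneg (Real.sqrt_nonneg _), Real.rpow_neg hR0.le, ← Real.sqrt_eq_rpow, ← Real.sqrt_inv]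
      apply Real.sqrt_le_sqrt
      rw [div_le_iff₀ (by positivity), inv_mul_eq_div, le_div_iff₀ hR0]
      nlinarith [Real.pi_gt_three]
    calc |Real.sqrt (2 / (π * R))| * |Real.cos (R - n * π / 2 - π / 4)| ≤ R ^ (-(1 / 2 : ℝ)) * 1 :=
          mul_le_mul hs hc (abs_nonneg _) (Real.rpow_nonneg hR0.le _)
      _ = _ := mul_one _
  have hJb : ∀ n R, 1 ≤ R → |besselJ n R| ≤ (1 + κ n) * R ^ (-(1 / 2 : ℝ)) := by
    intro n R hR
    have hR0 : 0 < R := by linarith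
    have h1 := hE n R hR0
    have h2 := hMb n R hR
    have hRR : 1 / R ≤ R ^ (-(1 / 2 : ℝ)) := by
      rw [Real.rpow_neg hR0.le, one_div]
      apply inv_anti₀ (Real.rpow_pos_of_pos hR0 _)
      calc R ^ (1 / 2 : ℝ) ≤ R ^ (1 : ℝ) := Real.rpow_le_rpow_of_exponent_le hR (by norm_num)
        _ = R := Real.rpow_one R
    calc |besselJ n R| = |M n R + (besselJ n R - M n R)| := by ring_nf
      _ ≤ |M n R| + |besselJ n R - M n R| := abs_add_le _ _
      _ ≤ R ^ (-(1 / 2 : ℝ)) + κ n / R := add_le_add h2 h1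
      _ ≤ R ^ (-(1 / 2 : ℝ)) + κ n * R ^ (-(1 / 2 : ℝ)) := by
          have := mul_le_mul_of_nonneg_left hRR (hκ0 n)
          have e : κ n / R = κ n * (1 / R) := by ring
          linarith
      _ = (1 + κ n) * R ^ (-(1 / 2 : ℝ)) := by ring
  -- the constant bound
  set B : ℝ := κ (m + 1) + κ l * (1 + κ (m + 1)) + κ m + κ (l + 1) * (1 + κ m) + |((l : ℝ) - m)| * ((1 + κ l) * (1 + κ m))
    with hB
  have hmain : ∀ R : ℝ, 1 ≤ R → |besselW l m R - 2 / π * Real.sin (((l : ℝ) - m) * π / 2)| ≤ B * R ^ (-(1 / 2 : ℝ)) := by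
    intro R hR
    have hR0 : 0 < R := by linarith
    have hW := hankelMain_wronskian l m hR0
    set r := R ^ (-(1 / 2 : ℝ)) with hr
    have hr0 : 0 < r := Real.rpow_pos_of_pos hR0 _
    have hRr : 1 / R ≤ r := by
      rw [hr, Real.rpow_neg hR0.le, one_div]
      apply inv_anti₀ (Real.rpow_pos_of_pos hR0 _)
      calc R ^ (1 / 2 : ℝ) ≤ R ^ (1 : ℝ) := Real.rpow_le_rpow_of_exponent_le hR (by norm_num)
        _ = R := Real.rpow_one R
    -- errors
    set el := besselJ l R - M l R
    set em := besselJ m R - M m R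
    set el1 := besselJ (l + 1) R - M (l + 1) R
    set em1 := besselJ (m + 1) R - M (m + 1) R
    have bel : |el| ≤ κ l / R := hE l R hR0
    have bem : |em| ≤ κ m / R := hE m R hR0
    have bel1 : |el1| ≤ κ (l + 1) / R := hE (l + 1) R hR0
    have bem1 : |em1| ≤ κ (m + 1) / R := hE (m + 1) R hR0
    have bMl : |M l R| ≤ r := hMb l R hR
    have bMl1 : |M (l + 1) R| ≤ r := hMb (l + 1) R hR
    have bJm : |besselJ m R| ≤ (1 + κ m) * r := hJb m R hR
    have bJm1 : |besselJ (m + 1) R| ≤ (1 + κ (m + 1)) * r := hJb (m + 1) R hR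
    have bJl : |besselJ l R| ≤ (1 + κ l) * r := hJb l R hR
    -- decomposition
    have hdec : besselW l m R - 2 / π * Real.sin (((l : ℝ) - m) * π / 2) =
        ((l : ℝ) - m) * besselJ l R * besselJ m R +
          R * (M l R * em1 + el * besselJ (m + 1) R - M (l + 1) R * em - el1 * besselJ m R) := by
      rw [← hW]
      simp only [besselW, hM]
      ring
    rw [hdec]
    have t0 : |((l : ℝ) - m) * besselJ l R * besselJ m R| ≤ |((l : ℝ) - m)| * ((1 + κ l) * (1 + κ m)) * r := by
      rw [abs_mul, abs_mul]
      have hr1 : r ≤ 1 := by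
        rw [hr, Real.rpow_neg hR0.le]
        exact inv_le_one_of_one_le₀ (Real.one_le_rpow hR (by norm_num))
      have hK : 0 ≤ |((l : ℝ) - m)| * ((1 + κ l) * (1 + κ m)) * r :=
        mul_nonneg (mul_nonneg (abs_nonneg _) (mul_nonneg (by linarith [hκ0 l]) (by linarith [hκ0 m]))) hr0.le
      have hkl : 0 ≤ 1 + κ l := by linarith [hκ0 l]
      calc |((l : ℝ) - m)| * |besselJ l R| * |besselJ m R| ≤ |((l : ℝ) - m)| * ((1 + κ l) * r) * ((1 + κ m) * r) :=
            mul_le_mul (mul_le_mul_of_nonneg_left bJl (abs_nonneg _)) bJm (abs_nonneg _)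
              (mul_nonneg (abs_nonneg _) (mul_nonneg hkl hr0.le))
        _ = |((l : ℝ) - m)| * ((1 + κ l) * (1 + κ m)) * r * r := by ring
        _ ≤ |((l : ℝ) - m)| * ((1 + κ l) * (1 + κ m)) * r * 1 := mul_le_mul_of_nonneg_left hr1 hK
        _ = _ := by ring
    have t1 : |R * (M l R * em1 + el * besselJ (m + 1) R - M (l + 1) R * em - el1 * besselJ m R)| ≤
        (κ (m + 1) + κ l * (1 + κ (m + 1)) + κ m + κ (l + 1) * (1 + κ m)) * r := by
      rw [abs_mul, abs_of_pos hR0]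
      have s1 : |M l R * em1| ≤ r * (κ (m + 1) / R) := by rw [abs_mul]; exact mul_le_mul bMl bem1 (abs_nonneg _) hr0.le
      have s2 : |el * besselJ (m + 1) R| ≤ (κ l / R) * ((1 + κ (m + 1)) * r) := by
        rw [abs_mul]; exact mul_le_mul bel bJm1 (abs_nonneg _) (by positivity)
      have s3 : |M (l + 1) R * em| ≤ r * (κ m / R) := by rw [abs_mul]; exact mul_le_mul bMl1 bem (abs_nonneg _) hr0.le
      have s4 : |el1 * besselJ m R| ≤ (κ (l + 1) / R) * ((1 + κ m) * r) := by
        rw [abs_mul]; exact mul_le_mul bel1 bJm (abs_nonneg _) (by positivity)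
      have hsum : |M l R * em1 + el * besselJ (m + 1) R - M (l + 1) R * em - el1 * besselJ m R| ≤
          r * (κ (m + 1) / R) + (κ l / R) * ((1 + κ (m + 1)) * r) + r * (κ m / R) + (κ (l + 1) / R) * ((1 + κ m) * r) := by
        refine (abs_sub _ _).trans (add_le_add ((abs_sub _ _).trans (add_le_add ((abs_add_le _ _).trans (add_le_add s1 s2)) s3)) s4)
      calc R * |M l R * em1 + el * besselJ (m + 1) R - M (l + 1) R * em - el1 * besselJ m R|
          ≤ R * (r * (κ (m + 1) / R) + (κ l / R) * ((1 + κ (m + 1)) * r) + r * (κ m / R) + (κ (l + 1) / R) * ((1 + κ m) * r)) := by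
            gcongr
        _ = (κ (m + 1) + κ l * (1 + κ (m + 1)) + κ m + κ (l + 1) * (1 + κ m)) * r := by
            field_simp
    calc _ ≤ |((l : ℝ) - m) * besselJ l R * besselJ m R| +
          |R * (M l R * em1 + el * besselJ (m + 1) R - M (l + 1) R * em - el1 * besselJ m R)| := abs_add_le _ _
      _ ≤ |((l : ℝ) - m)| * ((1 + κ l) * (1 + κ m)) * r + (κ (m + 1) + κ l * (1 + κ (m + 1)) + κ m + κ (l + 1) * (1 + κ m)) * r :=
          add_le_add t0 t1
      _ = B * r := by rw [hB]; ring
  -- squeeze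
  have hlim : Tendsto (fun R : ℝ => B * R ^ (-(1 / 2 : ℝ))) atTop (𝓝 0) := by
    have := (tendsto_rpow_neg_atTop (by norm_num : (0 : ℝ) < 1 / 2)).const_mul B
    simpa using this
  have h0 : Tendsto (fun R => besselW l m R - 2 / π * Real.sin (((l : ℝ) - m) * π / 2)) atTop (𝓝 0) := by
    refine squeeze_zero_norm' ?_ hlim
    filter_upwards [Filter.eventually_ge_atTop (1 : ℝ)] with R hR
    rw [Real.norm_eq_abs]; exact hmain R hR
  have := h0.add_const (2 / π * Real.sin (((l : ℝ) - m) * π / 2))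
  simpa using this

/-- **The Weber–Schafheitlin integral `∫₀^∞ J_ℓ(x)J_m(x) dx/x = 2 sin((ℓ−m)π/2)/(π(ℓ²−m²))`** for integers
`ℓ ≠ m` with `ℓ + m ≥ 1` [Iwaniec2002, (B.37) (`Re(μ+ν) > 0`); Watson §13.42]; in particular the ORTHOGONALITY
`∫₀^∞ J_ℓJ_m dx/x = 0` for `ℓ ≡ m (mod 2)`, `ℓ ≠ m`, behind the Neumann series (B.44)–(B.46) and (B.50). Proof: the
Wronskian `W_{ℓm} = x(J_ℓ'J_m − J_ℓJ_m')` has `W' = (ℓ²−m²)J_ℓJ_m/x`, `W(0) = 0`, and `W(R) → (2/π)sin((ℓ−m)π/2)` by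
Hankel's asymptotics (`abs_besselJ_sub_hankel_le`). (The tree's `integral_Ioi_besselJ_zero_mul_besselJ_one_div = 2/π`
is the case `ℓ = 0`, `m = 1`.) [cite: Iwaniec2002, Appendix B.4 (B.37), B.5 (B.44)–(B.46), PDF pp. 205–206] -/
theorem integral_Ioi_besselJ_mul_besselJ_div {l m : ℕ} (hlm : l ≠ m) (hlm1 : 1 ≤ l + m) :
    ∫ x in Set.Ioi (0 : ℝ), besselJ l x * besselJ m x / x =
      2 * Real.sin (((l : ℝ) - m) * π / 2) / (π * (((l : ℝ)) ^ 2 - (m : ℝ) ^ 2)) := by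
  have hπ := Real.pi_pos
  have hint := integrableOn_besselJ_mul_besselJ_div hlm1
  have hlim := intervalIntegral_tendsto_integral_Ioi 0 hint tendsto_id
  have hlim2 : Tendsto (fun R => ∫ x in (0 : ℝ)..R, besselJ l x * besselJ m x / x) atTop
      (𝓝 (2 / π * Real.sin (((l : ℝ) - m) * π / 2) / (((l : ℝ)) ^ 2 - (m : ℝ) ^ 2))) := by
    have h := (tendsto_besselW l m).div_const (((l : ℝ)) ^ 2 - (m : ℝ) ^ 2)
    refine h.congr' ?_
    filter_upwards [Filter.eventually_ge_atTop (0 : ℝ)] with R hR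
    exact (integral_besselJ_mul_besselJ_div_eq hlm hR).symm
  rw [tendsto_nhds_unique hlim hlim2]
  field_simp

/-- **Orthogonality of `J_ℓ`, `J_m` in `L²((0,∞), dx/x)` for `ℓ ≡ m (mod 2)`, `ℓ ≠ m`, `ℓ + m ≥ 1`.**
[cite: Iwaniec2002, Appendix B.4 (B.37), B.5 (B.46), PDF pp. 205–206] -/
theorem integral_Ioi_besselJ_mul_besselJ_div_eq_zero {l m : ℕ} (hlm : l ≠ m) (hlm1 : 1 ≤ l + m)
    (hpar : l % 2 = m % 2) : ∫ x in Set.Ioi (0 : ℝ), besselJ l x * besselJ m x / x = 0 := by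
  rw [integral_Ioi_besselJ_mul_besselJ_div hlm hlm1]
  have : Real.sin (((l : ℝ) - m) * π / 2) = 0 := by
    -- `l − m = 2j` for an integer `j`
    have h2 : (2 : ℤ) ∣ (l : ℤ) - m := by
      have := Int.emod_emod_of_dvd
      omega
    obtain ⟨j, hj⟩ := h2
    have : ((l : ℝ) - m) * π / 2 = (j : ℝ) * π := by
      have : ((l : ℝ) - m) = ((((l : ℤ) - m : ℤ)) : ℝ) := by push_cast; ring
      rw [this, hj]; push_cast; ring
    rw [this, Real.sin_int_mul_pi]
  rw [this]; simp

end Literature.Analysis.FunctionSpaces
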